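import Summits.Ventures.CertifiedManyBodySolver.Rows.CorrWindowBoxGeometry
import Summits.Ventures.CertifiedManyBodySolver.Rows.CorrWindowCertDictionaries
import HarnessLib

/-!
# The KERNEL-CHEAP window Hamiltonian list of a box: `O(N)` terms built from the eight bond offsets per site with the arithmetic
# tables of `Rows/CorrWindowBoxGeometry.lean`, denoting the same operator as `hamTermsIdx` (hence the dictionary theorem by name)

HONEST FRAMING: Lean plumbing towards «tier P» (HOME/STATUS captain R-g3-9 / (P2′)): `hamTermsIdx t tp U xs` enumerates ALL `N²` site
pairs and decides `zdGraph` / diagonal adjacency for each — measured ≈ 2.5 ms per decision in the kernel, i.e. ≈ 16 min per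
evaluation at `N = 625`, paid by every eom slice and by the far check. `hamTermsBox R t tp U` enumerates, per site `x` of the box, the
four unit and four diagonal OFFSETS `e`, keeps `x + e` when it is in the box (`inBoxB`, integer comparisons) and reads its index by
`boxIx` — `8N` cheap tests. `termOp_hamTermsBox_eq`: it denotes what `hamTermsIdx t tp U (boxXs R)` denotes (a reindexing of the
adjacent pairs by offsets, `zdGraph_adj_iff` / `diagAdjB_eq_true_iff`), so `termOp_hamTermsBox` IS the window-Hamiltonian dictionary for
the box by `termOp_hamTermsIdx`. No certificate, no number of record; CONTROL/CALIBRATION context (wording (xx1)); no summit statement is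
proved by this file. Seat hubbard-obs-p2 (STIFFNESS), `prover-hubbard-obs-p2-g23-0`, zero compute.

References: H. Xu et al., Science 384 (2024) eadh7691, eq. (1) (the `t–t'–U` Hamiltonian) [XuEtAl2024]; S. Friedli, Y. Velenik,
*Statistical Mechanics of Lattice Systems* §3.1–§3.2 (`ℤ^d`, boxes) [FriedliVelenikSMLS2017].
-/

namespace Summit.Ventures.CertifiedManyBodySolver

namespace CARPolyWindow

open Summit.Ventures.CertifiedQuantumChemistry Summit.Ventures.CertifiedQuantumChemistry.CARPoly
open Literature.MathematicalPhysics.QuantumLattice Literature.MathematicalPhysics.QuantumLattice.HubbardWave0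
open Literature.MathematicalPhysics.QuantumManyBody.StateRelaxation
open Literature.Probability.LatticeModels ThermodynamicLimit Filter Topology
open Matrix
open scoped ComplexOrder BigOperators

namespace BoxGeom

/-! ## Syntax (computable, `O(N)`) -/

/-- Box membership as integer comparisons. [folklore] -/
def inBoxB (R : ℕ) (v : Site 2) : Bool := decide (-(R : ℤ) ≤ v 0 ∧ v 0 ≤ R ∧ -(R : ℤ) ≤ v 1 ∧ v 1 ≤ R)

/-- `inBoxB` decides membership in `boxW`. [folklore] -/
theorem inBoxB_eq_true_iff {R : ℕ} {v : Site 2} : inBoxB R v = true ↔ v ∈ boxW R := by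
  rw [inBoxB, decide_eq_true_iff, mem_boxW, Fin.forall_fin_two]
  tauto

/-- The four unit-step offsets `±e₀, ±e₁`. [cite: FriedliVelenikSMLS2017, §3.1] -/
def nnOff : List (Site 2) := [Pi.single 0 1, Pi.single 1 1, -Pi.single 0 1, -Pi.single 1 1]

/-- The four diagonal offsets `±(1, 1), ±(1, −1)`. [cite: XuEtAl2024, eq. (1)] -/
def diagOff : List (Site 2) := [diagVec 0, diagVec 1, -diagVec 0, -diagVec 1]

/-- The hop from site `i` along the offset `e` with coefficient `c`, if the target is in the box. [cite: XuEtAl2024, eq. (1)] -/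
def hopOff (R : ℕ) (c : ℚ) (i : Fin (boxN R)) (e : Site 2) : Terms (Orb (Fin (boxN R))) :=
  if inBoxB R (boxXs R i + e) then hopT i (boxIx R (boxXs R i + e)) c else []

/-- **The kernel-cheap `t–t'–U` window Hamiltonian list of the box `R`** (same operator as `hamTermsIdx t tp U (boxXs R)`).
[cite: XuEtAl2024, eq. (1)] -/
def hamTermsBox (R : ℕ) (t tp U : ℚ) : Terms (Orb (Fin (boxN R))) :=
  ((finL (boxN R)).flatMap fun i => nnOff.flatMap (hopOff R (-t) i) ++ diagOff.flatMap (hopOff R (-tp) i)) ++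
    (finL (boxN R)).flatMap fun i => [([(orb i 0, true), (orb i 0, false), (orb i 1, true), (orb i 1, false)], U)]

/-! ## The reindexing -/

/-- `boxIx` inverts `boxXs`. [folklore] -/
theorem boxIx_boxXs (R : ℕ) (i : Fin (boxN R)) : boxIx R (boxXs R i) = i :=
  boxXs_injective R (boxXs_boxIx R _ (boxXs_mem R i))

/-- Nearest-neighbour adjacency = an offset of `nnOff`. [cite: FriedliVelenikSMLS2017, §3.1] -/
theorem zdGraph_adj_iff_nnOff (x y : Site 2) : (zdGraph 2).Adj x y ↔ ∃ e ∈ nnOff, y = x + e := by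
  rw [zdGraph_adj_iff, Fin.exists_fin_two]
  simp only [nnOff, List.mem_cons, List.not_mem_nil, or_false, exists_eq_or_imp, exists_eq_left]
  have hneg : ∀ s : Site 2, x = y + s ↔ y = x + -s := fun s => by
    constructor
    · intro h; rw [h]; abel
    · intro h; rw [h]; abel
  rw [hneg, hneg]
  tauto

/-- Diagonal adjacency = an offset of `diagOff`. [cite: XuEtAl2024, eq. (1)] -/
theorem diagAdjB_iff_diagOff (x y : Site 2) : diagAdjB x y = true ↔ ∃ e ∈ diagOff, y = x + e := by
  rw [diagAdjB_eq_true_iff, Fin.exists_fin_two, Fin.exists_fin_two]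
  simp only [diagOff, List.mem_cons, List.not_mem_nil, or_false, exists_eq_or_imp, exists_eq_left]
  have hneg : ∀ s : Site 2, x = y + s ↔ y = x + -s := fun s => by
    constructor
    · intro h; rw [h]; abel
    · intro h; rw [h]; abel
  rw [hneg, hneg]
  tauto

/-- **The reindexing lemma**: the sum over all sites `j` adjacent to `boxXs R i` equals the sum over the offsets whose target is in the
box, for ANY adjacency given by a duplicate-free offset list. [folklore] -/
theorem sum_adj_eq_termOp_hopOff {ι : Type*} [LinearOrder ι] [Fintype ι] (R : ℕ) (d : Orb (Fin (boxN R)) → ι)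
    (i : Fin (boxN R)) (c : ℚ) (offs : List (Site 2)) (hnd : offs.Nodup) (Adj : Site 2 → Site 2 → Prop) [DecidableRel Adj]
    (hAdj : ∀ x y, Adj x y ↔ ∃ e ∈ offs, y = x + e) :
    ∑ j : Fin (boxN R), (if Adj (boxXs R i) (boxXs R j) then termOp d (hopT i j c) else 0) =
      termOp d (offs.flatMap (hopOff R c i)) := by
  classical
  set x := boxXs R i with hx
  -- the offset side as a filtered Finset sum
  have hR : termOp d (offs.flatMap (hopOff R c i)) =
      ∑ e ∈ offs.toFinset.filter (fun e => x + e ∈ boxW R), termOp d (hopT i (boxIx R (x + e)) c) := by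
    rw [termOp_flatMap, ← List.sum_toFinset _ hnd, Finset.sum_filter]
    refine Finset.sum_congr rfl fun e _ => ?_
    rw [hopOff, ← hx]
    by_cases h : x + e ∈ boxW R
    · rw [if_pos (inBoxB_eq_true_iff.2 h), if_pos h]
    · have h' : ¬ (inBoxB R (x + e) = true) := fun hh => h (inBoxB_eq_true_iff.1 hh)
      rw [if_neg h', if_neg h, termOp_nil]
  rw [hR, ← Finset.sum_filter]
  -- the site side is the image of the offset side under `e ↦ boxIx (x + e)`
  have hset : (Finset.univ.filter fun j => Adj x (boxXs R j)) =
      (offs.toFinset.filter fun e => x + e ∈ boxW R).image fun e => boxIx R (x + e) := by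
    ext j
    rw [Finset.mem_filter, Finset.mem_image]
    constructor
    · rintro ⟨-, hj⟩
      obtain ⟨e, he, hje⟩ := (hAdj _ _).1 hj
      refine ⟨e, Finset.mem_filter.2 ⟨List.mem_toFinset.2 he, ?_⟩, ?_⟩
      · rw [← hje]; exact boxXs_mem R j
      · rw [← hje, boxIx_boxXs]
    · rintro ⟨e, he, rfl⟩
      obtain ⟨he, hin⟩ := Finset.mem_filter.1 he
      refine ⟨Finset.mem_univ _, (hAdj _ _).2 ⟨e, List.mem_toFinset.1 he, ?_⟩⟩
      rw [boxXs_boxIx R _ hin]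
  rw [hset, Finset.sum_image]
  intro e he e' he' hee
  obtain ⟨-, hin⟩ := Finset.mem_filter.1 he
  obtain ⟨-, hin'⟩ := Finset.mem_filter.1 he'
  have := congrArg (boxXs R) hee
  rw [boxXs_boxIx R _ hin, boxXs_boxIx R _ hin'] at this
  exact add_left_cancel this

/-- `nnOff` has no duplicates. [folklore] -/
theorem nodup_nnOff : nnOff.Nodup := by decide

/-- `diagOff` has no duplicates. [folklore] -/
theorem nodup_diagOff : diagOff.Nodup := by decide

/-! ## The dictionary -/

/-- **`hamTermsBox` denotes what `hamTermsIdx … (boxXs R)` denotes** (for any letter map). [cite: XuEtAl2024, eq. (1)] -/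
theorem termOp_hamTermsBox_eq {ι : Type*} [LinearOrder ι] [Fintype ι] (R : ℕ) (d : Orb (Fin (boxN R)) → ι) (t tp U : ℚ) :
    termOp d (hamTermsBox R t tp U) = termOp d (hamTermsIdx t tp U (boxXs R)) := by
  classical
  rw [hamTermsBox, hamTermsIdx, termOp_append, termOp_append, termOp_flatMap_finL, termOp_flatMap_finL, termOp_flatMap_finL]
  congr 1
  refine Finset.sum_congr rfl fun i _ => ?_
  rw [termOp_append, termOp_flatMap_finL]
  simp only [termOp_append, termOp_ite, Finset.sum_add_distrib]
  rw [sum_adj_eq_termOp_hopOff R d i (-t) nnOff nodup_nnOff (zdGraph 2).Adj zdGraph_adj_iff_nnOff,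
    sum_adj_eq_termOp_hopOff R d i (-tp) diagOff nodup_diagOff (fun x y => diagAdjB x y = true) diagAdjB_iff_diagOff]

/-- **THE WINDOW-HAMILTONIAN DICTIONARY FOR A BOX, KERNEL-CHEAP**: `termOp (boxD R) (hamTermsBox R t tp U) = H^{t,tp,U}_{boxW R}`.
[cite: XuEtAl2024, eq. (1)] -/
theorem termOp_hamTermsBox (R : ℕ) (t tp U : ℚ) :
    termOp (boxD R) (hamTermsBox R t tp U) =
      (hubbardTTPrimeFermionInteraction (t : ℝ) (tp : ℝ) (U : ℝ)).localHamiltonian (boxW R) := by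
  rw [termOp_hamTermsBox_eq R (boxD R), termOp_hamTermsIdx t tp U (boxXs R) (boxXs_mem R) (boxXs_injective R) (boxXs_cover R) (boxD R)
    (boxD_orb R)]

/-! ## The box window IS the Literature box (for consumers stated on `box 2 R`) -/

/-- `boxW R = box 2 R` (`thicken {0} R` and Friedli–Velenik's centred cube coincide). [cite: FriedliVelenikSMLS2017, §3.2] -/
theorem boxW_eq_box (R : ℕ) : boxW R = box 2 R := by
  ext x
  rw [mem_boxW, mem_box]

/-- `box 2 r ⊆ boxW R` for `r ≤ R` (e.g. `box 2 7 ⊆ boxW 12`, the La214 nodes' window inside the Rm2 kernel window). [folklore] -/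
theorem box_subset_boxW {r R : ℕ} (h : r ≤ R) : box 2 r ⊆ boxW R := by
  rw [← boxW_eq_box]
  exact boxW_mono h

end BoxGeom

end CARPolyWindow

end Summit.Ventures.CertifiedManyBodySolver
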